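import Summits.QuantumFields.YangMills.Theorems.UnitScaleTiltProp7ProjRangeKernelDecayCoarseGram
import Summits.QuantumFields.YangMills.Theorems.UnitScaleTiltProp7AccretiveConjOperatorBound
import Mathlib.Analysis.InnerProductSpace.Projection.Basic
import Mathlib.Analysis.InnerProductSpace.PiL2
import HarnessLib

/-!
# Route `UnitScaleTilt`, crux K1 «MinimiserStabilityRegPr» (stmt-QuantumFields-19200), EX row `hGF[Lift]` (curved member) — **LOD LINE BRICK (L5′-member), OPERATOR LAYER
# (routeR-w2 g12, LOCATE-L5-GRAMSHELLS 7416633c §0∕(P)): THE ORTHOGONAL PROJECTION ONTO THE SPAN OF A FINITE FAMILY `v_y` IS `P x = Σ_y (M⁻¹⟪v_·, x⟫)_y · v_y` (`M` the Gram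
# matrix), HENCE `⟪f, P g⟫ = Σ_{y,y′} conj⟪v_y, f⟫ · M⁻¹_{yy′} · ⟪v_{y′}, g⟫`, AND THE BILINEAR FORM OF `P` DECAYS BLOCK-TO-BLOCK AS SOON AS THE PAIRINGS `⟪v_y, f⟫` AND THE INVERSE
# GRAM DECAY — the operator-level twin of ✓`Prop7GramSandwichBlockBound`, one theorem for all four kernels `P, DP, PD*, DPD*`.**

Cell `ym3-torus` (HUMAN RULING D-0037, YM ladder rung R3 — NOT d = 4, NOT infinite volume, NOT a mass gap, NOT Clay).  Width seat `ym-routeR-w2` gen 12 (D-0154 (3c); chair ★p1 g24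
22:12:46Z (4) «(L5′-member) GRAM SHELLS», 22:38:36Z «(L5′-G) adopted»; ★★OWNER RULINGS №33∕№35).  THEOREMS ONLY (0 `def`, 0 `sorry`), Mathlib + ✓`Prop7ProjRangeKernelDecayCoarseGram`
(`exp_three_le`) + ✓`Prop7AccretiveConjOperatorBound` (`sum_normSq_inv_mulVec_le_of_accretive`, for the invertibility bridge of §3); `--supports stmt-QuantumFields-19200 --as helper`,
count-neutral.  HONEST LABEL (№33 (6)): curved γ-row supplier line (LOD localisation), abstract Hilbert-space
algebra; CONDITIONAL at the member on (L3′a) (the pairings ∕ block column norms), (L4′)∕(BUMP) (invertibility of the Gram matrix) and ✓`Prop7GramConjAccretive` (the inverse decay);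
nothing of (3.49), Thm 3.1∕3.3, `h349`, `hGF`, EX ∕ 19200 is proved here.

WHY.  At the member, print's complementary gauge projector `P(U₀) = 1 − R_{Q″}(U₀)` IS Mathlib's `starProjection` of `((ker Q″).map Δ_U)ᗮ` (lit ✓`B11Eq103H1Complex.projR`), and
✓`Prop7LODProjectorGlue.orthogonal_map_ker_eq_range_comp` identifies that subspace with `range (G_a ∘ T)` — the span of the finitely many columns `v_y := G_a(T ê_y)`.  The matrix rows
of the line (✓`Prop7ProjRangeKernelDecayCoarseGram` §2: `P = B M⁻¹ Bᴴ` is THE orthogonal projection onto `range B`; ✓`Prop7GramSandwichBlockBound`: its block bilinear bounds;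
✓`Prop7GramConjAccretive`: `M⁻¹` decays) meet that OPERATOR through the formula of §1 below, with no fine coordinates: for `f` supported in the coarse block `z` the pairing
`⟪v_y, f⟫` is bounded by the block column norm `‖r_z v_y‖·‖f‖` (block Cauchy–Schwarz, member side), and for the kernels with derivatives one pairs against `D†φ` instead of `f`
(`⟪v_y, D†φ⟫ = ⟪D v_y, φ⟫`), so ONE bound (§2) serves `P, DP, PD*, DPD*` — CARD-19200-V3-g24 §5's list for `hGF[Lift]`.

WHAT IS PROVED (ns `Summit.QuantumFields.YangMills.Theorems.Prop7SpanProjectorGramForm`; `E` a complex inner-product space, `v : m → E` a finite family, `M y y′ = ⟪v y, v y′⟫` with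
`IsUnit M.det`, `K` any submodule with an orthogonal projection, containing every `v y` and contained in their span).
* §1 `gram_mulVec_coeff_eq` (`Σ_{y′} M y y′ · (M⁻¹⟪v_·, x⟫)_{y′} = ⟪v y, x⟫`), ★ `inner_family_gramSum` (`⟪v y, Σ_{y′}(M⁻¹⟪v_·,x⟫)_{y′} • v y′⟫ = ⟪v y, x⟫`),
  ★★ `starProjection_eq_gramSum` (`K.starProjection x = Σ_y (Σ_{y′} M⁻¹ y y′ · ⟪v y′, x⟫) • v y`), ★★ `inner_starProjection_eq_gramSum`
  (`⟪f, K.starProjection g⟫ = Σ_y Σ_{y′} conj⟪v y, f⟫ · M⁻¹ y y′ · ⟪v y′, g⟫`).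
* §2 ★★ `norm_inner_starProjection_le` (`‖⟪v y, f⟫‖ ≤ a y`, `‖⟪v y′, g⟫‖ ≤ b y′` ⟹ `‖⟪f, K.starProjection g⟫‖ ≤ Σ_{y,y′} a y · ‖M⁻¹ y y′‖ · b y′`),
  `triple_sum_exp_le` (the coarse bookkeeping: `a ≤ C₁e^{−μ dc(z,·)}`, `b ≤ C₂e^{−μ dc(z′,·)}`, `‖M⁻¹ y y′‖ ≤ C_N e^{−μ′dc(y,y′)}`, `Σ_y e^{−(μ−μ′)dc(y,·)} ≤ cV′` ⟹
  `Σ ≤ C₁C₂C_N·cV′²·e^{−μ′ dc(z,z′)}`), ★★★ `norm_inner_starProjection_le_exp` (the two combined: block-to-block exponential decay of the bilinear form of `P`).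
* §3 (bridges to the matrix rows) `re_gram_form_eq` (`Re Σ_y c̄_y (Mc)_y = ‖Σ_y c_y • v_y‖²`), ★ `isUnit_gram_det_of_coercive` (`m₀·Σ‖c‖² ≤ ‖Σ c_y • v_y‖²`, `m₀ > 0` ⟹ `IsUnit M.det` —
  (L4′)'s coercivity discharges `hunit`), ★ `gram_eq_conjTranspose_mul_coords` (Parseval: in any orthonormal basis `b`, `B x y := ⟪b x, v y⟫` has `(BᴴB) y y′ = ⟪v y, v y′⟫` — the
  `hM : M = Bᴴ * B` of ✓`Prop7GramConjAccretive` ∕ ✓`Prop7ProjRangeKernelDecayCoarseGram`).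

References: T. Bałaban, CMP **99** (1985) 389–434 [Balaban1985BackgroundPropagators] ((3.20)–(3.23) p.394, (3.49) p.399); A. Målqvist, D. Peterseim, Math. Comp. **83** (2014)
2583–2603 [folklore] (localised bases of the multiscale space).
-/

set_option autoImplicit false

noncomputable section

open scoped InnerProductSpace ComplexConjugate BigOperators Matrix
open Finset

namespace Summit.QuantumFields.YangMills.Theorems.Prop7SpanProjectorGramForm

open Summit.QuantumFields.YangMills.Theorems.Prop7ProjRangeKernelDecayCoarseGram (exp_three_le)

variable {E : Type*} [NormedAddCommGroup E] [InnerProductSpace ℂ E] {m : Type*} [Fintype m] [DecidableEq m]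

/-! ## §1 The projection onto the span of a finite family through the inverse Gram matrix -/

/-- `Σ_{y′} M y y′ · (M⁻¹ w)_{y′} = w_y` for the pairing vector `w = ⟪v_·, x⟫` (`M M⁻¹ = 1`) — abstract-`M` twin of lit ✓`Literature.Analysis.InnerProduct.GramProjectionFormula.gram_mulVec_coeff`
(there `M = Matrix.gram 𝕜 v`, `LinearIndependent` instead of `IsUnit M.det`). [cite: Dym2023, Theorem 12.4 (proof), p. 128] [cite: Balaban1985BackgroundPropagators, (3.21) p.394] -/
theorem gram_mulVec_coeff_eq (v : m → E) (M : Matrix m m ℂ) (hunit : IsUnit M.det) (x : E) (y : m) :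
    ∑ y', M y y' * (∑ y'', M⁻¹ y' y'' * ⟪v y'', x⟫_ℂ) = ⟪v y, x⟫_ℂ := by
  have h2 : ∑ y', M y y' * (∑ y'', M⁻¹ y' y'' * ⟪v y'', x⟫_ℂ) = ((M * M⁻¹) *ᵥ (fun y'' => ⟪v y'', x⟫_ℂ)) y := by
    rw [← Matrix.mulVec_mulVec]; rfl
  rw [h2, Matrix.mul_nonsing_inv M hunit, Matrix.one_mulVec]

/-- ★ **THE GRAM SUM REPRODUCES THE PAIRINGS**: `⟪v y, Σ_{y′} (M⁻¹⟪v_·, x⟫)_{y′} • v y′⟫ = ⟪v y, x⟫` when `M y y′ = ⟪v y, v y′⟫` is invertible.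
[cite: Balaban1985BackgroundPropagators, (3.21) p.394] -/
theorem inner_family_gramSum (v : m → E) {M : Matrix m m ℂ} (hM : ∀ y y', M y y' = ⟪v y, v y'⟫_ℂ) (hunit : IsUnit M.det) (x : E) (y : m) :
    ⟪v y, ∑ y', (∑ y'', M⁻¹ y' y'' * ⟪v y'', x⟫_ℂ) • v y'⟫_ℂ = ⟪v y, x⟫_ℂ := by
  rw [inner_sum]
  calc ∑ y', ⟪v y, (∑ y'', M⁻¹ y' y'' * ⟪v y'', x⟫_ℂ) • v y'⟫_ℂ
      = ∑ y', M y y' * (∑ y'', M⁻¹ y' y'' * ⟪v y'', x⟫_ℂ) := Finset.sum_congr rfl fun y' _ => by rw [inner_smul_right, hM y y', mul_comm]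
    _ = ⟪v y, x⟫_ℂ := gram_mulVec_coeff_eq v M hunit x y

/-- ★★ **THE PROJECTION FORMULA**: for a submodule `K` carrying an orthogonal projection, containing every `v y` and contained in their span, and an invertible Gram matrix:
`K.starProjection x = Σ_y (Σ_{y′} M⁻¹ y y′ · ⟪v y′, x⟫) • v y`.  Abstract-letter twin (any `M` with `M y y′ = ⟪v y, v y′⟫` and `IsUnit M.det`, any sandwiched `K` — the letters the
member supplies BY NAME: `K := ((ker Q″).map Δ)ᗮ`, `M := BᴴB` by §3) of lit ✓`Literature.Analysis.InnerProduct.GramProjectionFormula.starProjection_eq_sum_gramInv_mulVec` (Dym 2023,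
Thm 12.4 (12.13): `K = span (range v)`, `M = Matrix.gram 𝕜 v`, `LinearIndependent 𝕜 v`); same skeleton of proof. [cite: Dym2023, Theorem 12.4 (12.13), pp. 127–128]
[cite: Balaban1985BackgroundPropagators, (3.20)–(3.22) p.394] -/
theorem starProjection_eq_gramSum (v : m → E) {M : Matrix m m ℂ} (hM : ∀ y y', M y y' = ⟪v y, v y'⟫_ℂ) (hunit : IsUnit M.det)
    (K : Submodule ℂ E) [K.HasOrthogonalProjection] (hvK : ∀ y, v y ∈ K) (hKv : K ≤ Submodule.span ℂ (Set.range v)) (x : E) :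
    K.starProjection x = ∑ y, (∑ y', M⁻¹ y y' * ⟪v y', x⟫_ℂ) • v y := by
  refine Submodule.eq_starProjection_of_mem_of_inner_eq_zero (Submodule.sum_mem _ fun y _ => Submodule.smul_mem _ _ (hvK y)) ?_
  intro w hw
  obtain ⟨c, rfl⟩ := (Submodule.mem_span_range_iff_exists_fun ℂ).1 (hKv hw)
  rw [inner_sum]
  refine Finset.sum_eq_zero fun y _ => ?_
  rw [inner_smul_right, inner_sub_left, ← inner_conj_symm x (v y), ← inner_conj_symm (∑ y', (∑ y'', M⁻¹ y' y'' * ⟪v y'', x⟫_ℂ) • v y') (v y),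
    inner_family_gramSum v hM hunit x y, sub_self, mul_zero]

/-- ★★ **THE BILINEAR FORM OF THE PROJECTION THROUGH THE INVERSE GRAM MATRIX**: `⟪f, K.starProjection g⟫ = Σ_y Σ_{y′} conj⟪v y, f⟫ · M⁻¹ y y′ · ⟪v y′, g⟫`.
[cite: Balaban1985BackgroundPropagators, (3.21) p.394, (3.49) p.399] -/
theorem inner_starProjection_eq_gramSum (v : m → E) {M : Matrix m m ℂ} (hM : ∀ y y', M y y' = ⟪v y, v y'⟫_ℂ) (hunit : IsUnit M.det)
    (K : Submodule ℂ E) [K.HasOrthogonalProjection] (hvK : ∀ y, v y ∈ K) (hKv : K ≤ Submodule.span ℂ (Set.range v)) (f g : E) :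
    ⟪f, K.starProjection g⟫_ℂ = ∑ y, ∑ y', (starRingEnd ℂ) ⟪v y, f⟫_ℂ * M⁻¹ y y' * ⟪v y', g⟫_ℂ := by
  rw [starProjection_eq_gramSum v hM hunit K hvK hKv g, inner_sum]
  refine Finset.sum_congr rfl fun y _ => ?_
  rw [inner_smul_right, ← inner_conj_symm f (v y), Finset.sum_mul]
  refine Finset.sum_congr rfl fun y' _ => ?_
  ring

/-! ## §2 Block-to-block decay of the bilinear form -/

/-- ★★ **THE BILINEAR BOUND**: pairing bounds `‖⟪v y, f⟫‖ ≤ a y`, `‖⟪v y′, g⟫‖ ≤ b y′` give `‖⟪f, K.starProjection g⟫‖ ≤ Σ_y Σ_{y′} a y · ‖M⁻¹ y y′‖ · b y′`.  (Member: `f` supported in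
the coarse block `z` ⟹ `a y = ‖r_z v_y‖·‖f‖` by block Cauchy–Schwarz; for `DP`, `PD*`, `DPD*` pair against `D†φ`: `⟪v y, D†φ⟫ = ⟪D v_y, φ⟫`, `a y = ‖r_z(D v_y)‖·‖φ‖`.)
[cite: Balaban1985BackgroundPropagators, (3.49) p.399] -/
theorem norm_inner_starProjection_le (v : m → E) {M : Matrix m m ℂ} (hM : ∀ y y', M y y' = ⟪v y, v y'⟫_ℂ) (hunit : IsUnit M.det)
    (K : Submodule ℂ E) [K.HasOrthogonalProjection] (hvK : ∀ y, v y ∈ K) (hKv : K ≤ Submodule.span ℂ (Set.range v)) (f g : E)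
    (a b : m → ℝ) (ha : ∀ y, ‖⟪v y, f⟫_ℂ‖ ≤ a y) (hb : ∀ y', ‖⟪v y', g⟫_ℂ‖ ≤ b y') :
    ‖⟪f, K.starProjection g⟫_ℂ‖ ≤ ∑ y, ∑ y', a y * ‖M⁻¹ y y'‖ * b y' := by
  rw [inner_starProjection_eq_gramSum v hM hunit K hvK hKv f g]
  refine (norm_sum_le _ _).trans (Finset.sum_le_sum fun y _ => (norm_sum_le _ _).trans (Finset.sum_le_sum fun y' _ => ?_))
  rw [norm_mul, norm_mul, RCLike.norm_conj]
  have ha0 : 0 ≤ a y := (norm_nonneg _).trans (ha y)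
  exact mul_le_mul (mul_le_mul (ha y) le_rfl (norm_nonneg _) ha0) (hb y') (norm_nonneg _) (mul_nonneg ha0 (norm_nonneg _))

omit [DecidableEq m] in
/-- **THE COARSE BOOKKEEPING** (✓`Prop7GramSandwichBlockBound.norm_form_sandwich_le_exp`'s arithmetic): `a y ≤ C₁e^{−μ dc(z,y)}`, `b y′ ≤ C₂e^{−μ dc(z′,y′)}`, `N y y′ ≤ C_N e^{−μ′dc(y,y′)}`
with `0 ≤ μ′`, and the coarse volume `Σ_y e^{−(μ−μ′)dc(y,z)} ≤ cV′` ⟹ `Σ_{y,y′} a y · N y y′ · b y′ ≤ C₁C₂C_N·cV′²·e^{−μ′ dc(z,z′)}`.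
[cite: Balaban1985BackgroundPropagators, (3.49) p.399] -/
theorem triple_sum_exp_le (dc : m → m → ℝ) (hds : ∀ i j, dc i j = dc j i) (hdt : ∀ i j k, dc i k ≤ dc i j + dc j k)
    (a b : m → ℝ) (N : m → m → ℝ) {C₁ C₂ CN μ μ' cV' : ℝ} (hC₁ : 0 ≤ C₁) (hC₂ : 0 ≤ C₂) (hCN : 0 ≤ CN) (hμ' : 0 ≤ μ')
    (hb0 : ∀ y, 0 ≤ b y) (hN0 : ∀ y y', 0 ≤ N y y') (z z' : m)
    (ha : ∀ y, a y ≤ C₁ * Real.exp (-(μ * dc z y))) (hb : ∀ y', b y' ≤ C₂ * Real.exp (-(μ * dc z' y')))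
    (hN : ∀ y y', N y y' ≤ CN * Real.exp (-(μ' * dc y y'))) (hvol' : ∀ w, ∑ y, Real.exp (-((μ - μ') * dc y w)) ≤ cV') :
    ∑ y, ∑ y', a y * N y y' * b y' ≤ C₁ * C₂ * CN * cV' ^ 2 * Real.exp (-(μ' * dc z z')) := by
  have hcV' : 0 ≤ cV' := le_trans (Finset.sum_nonneg fun y _ => (Real.exp_pos _).le) (hvol' z)
  have hterm : ∀ y y', a y * N y y' * b y'
      ≤ C₁ * C₂ * CN * Real.exp (-(μ' * dc z z')) * (Real.exp (-((μ - μ') * dc z y)) * Real.exp (-((μ - μ') * dc z' y'))) := by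
    intro y y'
    have ht : dc z z' ≤ dc z y + dc y y' + dc z' y' := by
      have := hdt z y z'; have h2 := hdt y y' z'; rw [hds y' z'] at h2; linarith
    have h3 := exp_three_le (μ := μ) (a := dc z y) (b := dc y y') (c := dc z' y') hμ' ht
    calc a y * N y y' * b y' ≤ (C₁ * Real.exp (-(μ * dc z y))) * (CN * Real.exp (-(μ' * dc y y'))) * (C₂ * Real.exp (-(μ * dc z' y'))) :=
          mul_le_mul (mul_le_mul (ha y) (hN y y') (hN0 y y') (by positivity)) (hb y') (hb0 y') (by positivity)
      _ = C₁ * C₂ * CN * (Real.exp (-(μ * dc z y)) * Real.exp (-(μ' * dc y y')) * Real.exp (-(μ * dc z' y'))) := by ring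
      _ ≤ C₁ * C₂ * CN * (Real.exp (-(μ' * dc z z')) * (Real.exp (-((μ - μ') * dc z y)) * Real.exp (-((μ - μ') * dc z' y')))) :=
          mul_le_mul_of_nonneg_left h3 (by positivity)
      _ = _ := by ring
  refine (Finset.sum_le_sum fun y _ => Finset.sum_le_sum fun y' _ => hterm y y').trans ?_
  have hsum : ∑ y, ∑ y', C₁ * C₂ * CN * Real.exp (-(μ' * dc z z')) * (Real.exp (-((μ - μ') * dc z y)) * Real.exp (-((μ - μ') * dc z' y')))
      = C₁ * C₂ * CN * Real.exp (-(μ' * dc z z')) * ((∑ y, Real.exp (-((μ - μ') * dc z y))) * ∑ y', Real.exp (-((μ - μ') * dc z' y'))) := by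
    rw [Finset.sum_mul, Finset.mul_sum]
    refine Finset.sum_congr rfl fun y _ => ?_
    rw [Finset.mul_sum, Finset.mul_sum]
  rw [hsum]
  have hza : ∑ y, Real.exp (-((μ - μ') * dc z y)) ≤ cV' := by have := hvol' z; simpa [hds] using this
  have hzb : ∑ y', Real.exp (-((μ - μ') * dc z' y')) ≤ cV' := by have := hvol' z'; simpa [hds] using this
  have hab : (∑ y, Real.exp (-((μ - μ') * dc z y))) * ∑ y', Real.exp (-((μ - μ') * dc z' y')) ≤ cV' * cV' :=
    mul_le_mul hza hzb (Finset.sum_nonneg fun _ _ => (Real.exp_pos _).le) hcV'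
  calc C₁ * C₂ * CN * Real.exp (-(μ' * dc z z')) * ((∑ y, Real.exp (-((μ - μ') * dc z y))) * ∑ y', Real.exp (-((μ - μ') * dc z' y')))
      ≤ C₁ * C₂ * CN * Real.exp (-(μ' * dc z z')) * (cV' * cV') := mul_le_mul_of_nonneg_left hab (by positivity)
    _ = C₁ * C₂ * CN * cV' ^ 2 * Real.exp (-(μ' * dc z z')) := by ring

/-- ★★★ **BLOCK-TO-BLOCK EXPONENTIAL DECAY OF THE BILINEAR FORM OF THE PROJECTION**: pairings of `f` (resp. `g`) with the family decaying away from the coarse block `z` (resp. `z′`)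
at rate `μ`, the inverse Gram matrix decaying at rate `μ′ ≤ μ` (so `0 ≤ μ′`) and the coarse volume bound at rate `μ − μ′` give
`‖⟪f, K.starProjection g⟫‖ ≤ C₁C₂C_N·cV′²·e^{−μ′ dc(z,z′)}` — K-uniform at a member (all constants coarse). [cite: Balaban1985BackgroundPropagators, (3.49) p.399] -/
theorem norm_inner_starProjection_le_exp (v : m → E) {M : Matrix m m ℂ} (hM : ∀ y y', M y y' = ⟪v y, v y'⟫_ℂ) (hunit : IsUnit M.det)
    (K : Submodule ℂ E) [K.HasOrthogonalProjection] (hvK : ∀ y, v y ∈ K) (hKv : K ≤ Submodule.span ℂ (Set.range v)) (f g : E)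
    (dc : m → m → ℝ) (hds : ∀ i j, dc i j = dc j i) (hdt : ∀ i j k, dc i k ≤ dc i j + dc j k)
    {C₁ C₂ CN μ μ' cV' : ℝ} (hC₁ : 0 ≤ C₁) (hC₂ : 0 ≤ C₂) (hCN : 0 ≤ CN) (hμ' : 0 ≤ μ') (z z' : m)
    (ha : ∀ y, ‖⟪v y, f⟫_ℂ‖ ≤ C₁ * Real.exp (-(μ * dc z y))) (hb : ∀ y', ‖⟪v y', g⟫_ℂ‖ ≤ C₂ * Real.exp (-(μ * dc z' y')))
    (hN : ∀ y y', ‖M⁻¹ y y'‖ ≤ CN * Real.exp (-(μ' * dc y y'))) (hvol' : ∀ w, ∑ y, Real.exp (-((μ - μ') * dc y w)) ≤ cV') :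
    ‖⟪f, K.starProjection g⟫_ℂ‖ ≤ C₁ * C₂ * CN * cV' ^ 2 * Real.exp (-(μ' * dc z z')) := by
  refine (norm_inner_starProjection_le v hM hunit K hvK hKv f g (fun y => ‖⟪v y, f⟫_ℂ‖) (fun y' => ‖⟪v y', g⟫_ℂ‖) (fun _ => le_rfl)
    (fun _ => le_rfl)).trans ?_
  exact triple_sum_exp_le dc hds hdt _ _ (fun y y' => ‖M⁻¹ y y'‖) hC₁ hC₂ hCN hμ' (fun _ => norm_nonneg _)
    (fun _ _ => norm_nonneg _) z z' ha hb hN hvol'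

/-! ## §3 Bridges to the matrix rows: accretivity ∕ invertibility of the Gram matrix, and Parseval coordinates -/

omit [DecidableEq m] in
/-- **THE GRAM FORM IS A NORM SQUARE**: `Re Σ_y c̄_y (M c)_y = ‖Σ_y c_y • v_y‖²` for `M y y′ = ⟪v y, v y′⟫`. [cite: Balaban1985BackgroundPropagators, (3.21) p.394] -/
theorem re_gram_form_eq (v : m → E) {M : Matrix m m ℂ} (hM : ∀ y y', M y y' = ⟪v y, v y'⟫_ℂ) (c : m → ℂ) :
    (∑ y, star (c y) * (M *ᵥ c) y).re = ‖∑ y, c y • v y‖ ^ 2 := by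
  have h : ∑ y, star (c y) * (M *ᵥ c) y = ⟪∑ y, c y • v y, ∑ y', c y' • v y'⟫_ℂ := by
    rw [sum_inner]
    refine Finset.sum_congr rfl fun y _ => ?_
    rw [inner_smul_left, inner_sum]
    have hmv : (M *ᵥ c) y = ∑ y', M y y' * c y' := rfl
    rw [hmv, Finset.mul_sum, Finset.mul_sum]
    refine Finset.sum_congr rfl fun y' _ => ?_
    rw [inner_smul_right, hM y y', Complex.star_def]; ring
  rw [h, inner_self_eq_norm_sq_to_K]; norm_cast

/-- ★ **COERCIVE FAMILY ⟹ INVERTIBLE GRAM MATRIX**: `m₀·Σ‖c_y‖² ≤ ‖Σ c_y • v_y‖²` with `m₀ > 0` makes `M` `m₀`-accretive, hence `IsUnit M.det` (✓`sum_normSq_inv_mulVec_le_of_accretive`)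
— at the member this is (L4′)'s coarse coercivity `‖G_a(Q″†c)‖ ≥ m_B|c|`. [cite: Balaban1985BackgroundPropagators, Thm 3.1 p.397] -/
theorem isUnit_gram_det_of_coercive (v : m → E) {M : Matrix m m ℂ} (hM : ∀ y y', M y y' = ⟪v y, v y'⟫_ℂ) {m₀ : ℝ} (hm₀ : 0 < m₀)
    (hcoer : ∀ c : m → ℂ, m₀ * ∑ y, ‖c y‖ ^ 2 ≤ ‖∑ y, c y • v y‖ ^ 2) : IsUnit M.det := by
  have hacc : ∀ c : m → ℂ, m₀ * ∑ y, ‖c y‖ ^ 2 ≤ (∑ y, star (c y) * (M *ᵥ c) y).re := fun c => by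
    rw [re_gram_form_eq v hM c]; exact hcoer c
  exact (Prop7AccretiveConjOperatorBound.sum_normSq_inv_mulVec_le_of_accretive M hm₀ hacc 0).1

omit [Fintype m] [DecidableEq m] in
/-- ★ **PARSEVAL COORDINATES**: in any orthonormal basis `b` of `E` the coordinate matrix `B x y := ⟪b x, v y⟫` satisfies `(BᴴB) y y′ = ⟪v y, v y′⟫` — so every matrix row of the line
stated with `M = Bᴴ * B` (✓`Prop7GramConjAccretive`, ✓`Prop7ProjRangeKernelDecayCoarseGram`) reads on the Gram matrix of the family. [cite: Balaban1985BackgroundPropagators, (3.21) p.394] -/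
theorem gram_eq_conjTranspose_mul_coords {n : Type*} [Fintype n] (b : OrthonormalBasis n ℂ E) (v : m → E) (y y' : m) :
    ((Matrix.of fun x y => ⟪b x, v y⟫_ℂ)ᴴ * Matrix.of fun x y => ⟪b x, v y⟫_ℂ) y y' = ⟪v y, v y'⟫_ℂ := by
  rw [Matrix.mul_apply, ← b.sum_inner_mul_inner (v y) (v y')]
  refine Finset.sum_congr rfl fun x _ => ?_
  rw [Matrix.conjTranspose_apply, Matrix.of_apply, Matrix.of_apply, Complex.star_def, inner_conj_symm]

end Summit.QuantumFields.YangMills.Theorems.Prop7SpanProjectorGramForm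

end
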